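import Literature.MathematicalPhysics.QuantumFieldTheory.Balaban1983to89.B8Prop3MultiLevelTorusP26
import Literature.MathematicalPhysics.QuantumFieldTheory.Balaban1983to89.B6SectACriticalPointV1

/-!
# `Balaban1983to89.B8Thm4MultiLevelTorus` — T. Bałaban, *Spaces of regular gauge field configurations on a lattice and gauge fixing
# conditions*, Commun. Math. Phys. **99** (1985) 75–102 [Balaban1985RegularSpaces], **THEOREM 4** p. 88 (and through it **THEOREM 2**
# p. 83): existence AND uniqueness of the restricted gauge transformation putting `U′U₀` into the Landau gauge w.r.t. `U₀`, with the
# bounds (1.36)–(1.39)/(1.62) and the average condition (1.37) — AT THE FLAT BACKGROUND `U₀ = 1`, in the linear (abelian) chart,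
# ON PRINT'S OWN MULTI-LEVEL CARRIER: the `k`-LEVEL V1 TORUS `T_η = Ω₁ ⊃ Ω₂ ⊃ … ⊃ Ω_k` (every odd `L ≥ 5`, `k ≥ 1`, `P′ ≥ 5L`),
# WITH THE GENUINE LEVEL PREFACTORS `(Lʲη)^{−γ}` — HYPOTHESIS-FREE (rows **B8.Thm4**, B8.Thm2, B8.Eq1.36, B8.Eq1.38, B8.Eq1.29 cells;
# heads unchanged)

statement-level skeleton of published theorems with citation tags; proofs where landed; nothing here is a claim about the Yang–Mills mass gap

PDF held: `paper:balaban1985-cmp99-regular-spaces-gauge-fixing` (journal page = PDF page + 74); pp. 81, 82, 87, 88 [PDF 7, 8, 13, 14]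
read AS IMAGES this session (renders `run/shared/lean/pub/pub-balaban/b2b-balaban-ref1/pages/1985-cmp99-regular-spaces-gauge-fixing/
1985-cmp99-regular-spaces-gauge-fixing-p0NN-x2.png`), pp. 83, 86 [PDF 9, 12] on the text layer (`p0009.txt`, `p0012.txt`); [B6] =
T. Bałaban, *Propagators and renormalization transformations for lattice gauge theories. II*, Commun. Math. Phys. **96** (1984) 223–250
[Balaban1984PropagatorsII], Sect. A pp. 224–225 through p21's verbatim quotations in `B6SectAOperatorsV1` / `B6SectACriticalPointV1`
(referee-signed files).

CITATION HEADER (lean-in-tree rule).  Cell `lit-balaban` (HOME `run/shared/lean/pub/lit-balaban/`), unit `lit-balaban-r05` gen 71 (B8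
reader/typer and fold owner; free target under protocol G.5-34(d), TAKING HOME/STATUS.md 2026-08-24T16:31:00Z, courtesy lines to p21 /
p38 / r03 / p40).  WHAT IS REPRODUCED = SKELETON rows **B8.Thm4** and **B8.Thm2** (+ cells B8.Eq1.36 / B8.Eq1.38 / B8.Eq1.29), as
«kernel-checked proofs of a model instance» on p21's `k`-level nested torus family `TDomains d ℓ M_h k P′ R` carrying r03's V1 global
chart (`B6GlobalChartV1`: `PV`, `domT`, `blkV1`) and p21's Sect.-A Hilbert-space calculus (`B6SectAOperatorsV1`: `∂ = dE`, `∂* = dsE`,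
curl `dcE` and its adjoint `dcsE`, the multi-scale averages `Q = QE`, `Q′ = QpE`, the orthogonal projection `R = RE` onto `ΔN(Q′)`).
Heads do not move (the printed generality — an arbitrary regular background `U₀` under (1.33), (1.34), (1.66), the contraction of
Sects. C–E, the operators of (1.91) with [4] Theorems 3.1–3.3 — is r06's block).  THIS MODULE is the multi-level item of the r05 FLAT
PROGRAMME (gen 18 `B8Thm4FlatTorus.thm4_flat`/`thm2_flat`: Theorems 4/2 at `U₀ = 1` for the CONSTANT domain sequence, one surviving
level; gens 61–70 `B8Prop3MultiLevelTorus*`: Proposition 3 at `U₀ = 1` on the `k`-level torus, v1.5 `…P26.prop3_multiLevelTorus_V1_P26_vector`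
with NO [B6]-side hypothesis, modulo the B8-side hypotheses (1.55)/(1.42)/(1.56) only): **Theorem 4 itself at `U₀ = 1` on the
`k`-level torus**, where those three B8-side hypotheses are exactly what the theorem's construction DISCHARGES.

WHAT IS PRINTED (verbatim).  p. 88 [PDF 14]: *"**Theorem 4.** There exists a constant c₁ such that for arbitrary U₀, U′U₀ satisfying
(1.33), (1.34), (1.66) with α₀ + α₁ ≦ c₁ there exists exactly one gauge transformation u satisfying (1.29) and such that the conditions
(1.37), (1.38), (1.62) hold for the configuration U₁ = U′^{u⁻¹}.  Of course this theorem implies Theorem 2. Proposition 3 implies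
that it is enough to prove (1.37), (1.38) and |A| < B′₁(α₀ + α₁)(Lʲη)⁻¹ on Ω_j, B′₁ = C′₁5B₀, (1.67) with an absolute constant C′₁,
i.e. a constant depending on d and L only."*  p. 83 [PDF 9]: *"**Theorem 2.** There exist constants B₁, B₂(β₀), c₁ such that for
arbitrary U₀, U′U₀ satisfying (1.33)–(1.35) with α₀ + α₁ ≦ c₁ there exists exactly one gauge transformation u satisfying (1.29) and
such that the conditions (1.36)–(1.39) hold for the configuration U₁ = U′^{u⁻¹}."*  p. 81 [PDF 7]: *"and let us consider the set
{U′^{u⁻¹}} for gauge transformations u satisfying the conditions (R₀uʲ‾)(y) = 1 for y ∈ Λ_j, j = 0, 1, …, k. (1.29)  Our problem is to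
prove that there exists a gauge transformation u such that U′^{u⁻¹}, or rather A = (1/i) log U′^{u⁻¹}, satisfies the Landau gauge
condition (1.27) and the bounds |A|, |∇^{L⁻ʲ}_{U₀}A| < O(α₀L⁻ʲ) on Ω_j. We would like to prove also that such a gauge transformation is
unique"*.  p. 82 [PDF 8]: *"Now our problem is to construct a gauge transformation u satisfying the equalities (1.29) and such that
U₁ = U′^{u⁻¹} satisfies the conditions U₁ = e^{iηA}, |A| < B₁(α₀ + α₁)(Lʲη)⁻¹, |∇^η_{U₀}A| < B₁(α₀ + α₁)(Lʲη)⁻², ‖A‖_{1,β} <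
B₂(β₀)(α₀ + α₁)(Lʲη)^{−2−β}, β ≦ β₀ < 1, on Ω_j, j = 0, 1, …, k, (1.36)  Q_j(U₀, ηA) = B on Λ_j, j = 0, 1, …, k, B is given by formula
(1.31) with V′ = Ũ′ʲ, |B| < 2dLα₁ by the assumption (1.35), (1.37)  R(U₀)D^{η*}_{U₀}A = 0. (1.38)"*; p. 83: *"|D^{η*}_{U₀}D^η_{U₀}A|,
|Δ^η_{U₀}A| < B₁(α₀ + α₁)(Lʲη)⁻³ on Ω_j, j = 0, 1, …, k. (1.39)"*; *"Also the condition (1.37) is basically of an algebraic character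
and it follows from the construction, as in (1.30), (1.31)."*  p. 86 [PDF 12]: *"This implies that D^{η*}_{U₀}D^η_{U₀}A = J, |J| ≦
(2α₀ + 36dα₂(Lʲη)²|∇^η_{U₀}A| + 50dα₂³ + 10dα₀α₂)(Lʲη)⁻³, (1.55)"*; *"The configuration A satisfies (1.42) also. Proposition 4 from
[3] implies that Q_j(U₀, ηA) = LʲηQ_jA + C_j(ηA), |C_j(ηA)| ≦ C₂|LʲηA|² < C₂α₂², (1.56) hence LʲηQ_jA = B₁, B₁ = B − C_j(LʲηA) on
Λ_j, |B₁| < 2dLα₁ + C₂α₂²."*  p. 87 [PDF 13]: *"|A| < 5dLB₀(α₀ + α₁)(Lʲη)⁻¹, |∇^η_{U₀}A| < 5dLB₀(α₀ + α₁)(Lʲη)⁻², ‖A‖_{1,β} <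
5dLB₀(β)(α₀ + α₁)(Lʲη)^{−2−β}, |D^{η*}_{U₀}D^η_{U₀}A|, |Δ^η_{U₀}A| < 5dLB₀(α₀ + α₁)(Lʲη)⁻³ on Ω_j. (1.62)"*; Prop. 3: *"then U₁
satisfies (1.36)–(1.39) with B₁ = 5dLB₀, B₂(β₀) = 5dLB₀(β₀), where B₀, B₀(β₀) are the corresponding norms of the operators G(U₀),
H(U₀), and depend on d and L only"*; (1.66): *"|(U′U₀)ʲ‾ − Ūʲ₀| = |Ũ′ʲ − 1| < α₁ on Ω⁽ʲ⁾_j, j = 0, 1, …, k. (1.66)"*.  [B6] p. 224–225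
(through `B6SectAOperatorsV1`/`B6SectACriticalPointV1`): *"gauge transformations λ: A → A^λ = A − ∂λ such that λ = 0 on Λ₀, Q′_jλ = 0
on Λ_j, j = 1, …, k. (2.7) … let R be an orthogonal projection in the space L²(T_η) onto the subspace ΔN(Q′) … Thus the functional
(2.8) has exactly one minimum on each orbit. This minimum satisfies the equation R∂*A^{λ₀} = 0 (2.12)"*.

THE INSTANCE (dictionary print ↦ Lean; the torus typing of the `B8Prop3MultiLevelTorus*` lineage, v1.5 `_vector`).  `U₀ = 1` on the
`k`-LEVEL V1 TORUS of p21/r03: `T_η = Site (PV d ℓ m K hd hL) 0` (dimension `d + 1`, `L = ℓ + 1` odd `≥ 5`), the nested family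
`D : TDomains d ℓ M_h k P′ R` read through r03's global chart as the Sect.-A domain record `domT hN D hk : Domains (PV …)` (levels
`1 … k`, `Ω₁ = T_η`; the block of a fine bond `b` is `blkV1 hN D b`, of side `(geomT D).len (blkV1 hN D b) = L^{j(b)}`), lattice factor
`c′ ≠ 0`, `η = |c′|⁻¹`, weights `w` in r03's `GlobalBand b₀ b₁ c′ w` (the `a_j(Lʲη)⁻²` of [B6] (2.18)).  THE LINEAR (ABELIAN) CHART — as in
gen 18's `B8Thm4FlatTorus` (ref-4 SIGNED) and gen 17's `B8Thm8FlatAbelianFamily.flatGF`: the perturbation `U′ = e^{iηA′}` IS the real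
bond field `A′ : BondSpace (PV …)` (scalar model of the `𝔤`-valued field, as in every torus file of the lineage); a gauge transformation
`u = e^{iλ}` IS the site field `λ : ScalarSpace (PV …)`; the action (1.17) `U′ ↦ U′^{u⁻¹}` IS [B6] (2.7)'s `A′ ↦ A′ − ∂λ` (`∂ = dE c′`; the
sign of `λ` is immaterial, `N(Q′)` being a subspace); the restriction (1.29) «(R₀uʲ‾)(y) = 1 for y ∈ Λ_j, j = 0, …, k» IS `λ ∈ N(Q′) =
ker Q′` — [B6] (2.7) «λ = 0 on Λ₀, Q′_jλ = 0 on Λ_j» = `LinearMap.ker (QpE (domT hN D hk))` (the linearisation of the exp-mean-arg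
averages (78)–(81) of [3]; cf. `B8Thm8U1Family.lift_restricted` for genuine `U(1)`-valued `u` at one level); `R(U₀)` at `U₀ = 1` IS [B6]'s
orthogonal projection `RE (domT hN D hk) c′` onto `ΔN(Q′)` and (1.38)/(1.42) IS `RE … (∂*A) = 0` with `∂* = dsE c′` (the standing reading of
the lineage since `B8Eq158FlatTorus`; [B6] (2.12)); `D^{η*}_{U₀}D^η_{U₀}` at `U₀ = 1` on vector fields IS `dcsE c′ ∘ dcE c′` (adjoint curl ∘
curl, [B6] (2.19)'s `∂*∂`; `B8Eq12HodgeLaplacianV1.dcsE_apply` = (1.2) word for word); `Q_j` IS the multi-scale `QE (domT hN D hk)`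
([B6] (2.20)); `∇^η_{U₀}` at `U₀ = 1` IS p38's componentwise forward difference `B6GradLegKLevelV1.DV ν c′`; `Δ^η_{U₀}` at `U₀ = 1` IS the
componentwise `LatticeFieldCalculus.laplace c′`; `|·|₍₋γ₎` IS `B8ScaledSupNorm.msup (ℓ+1) k η (−γ)` over the level map `b ↦ j(b)`
(p. 86 «|A|_(α) = sup_j sup_{Ω_j} (Lʲη)^{−α}|A|»).  THE HYPOTHESES of Theorems 2/4 read in the chart: (1.33) holds trivially at `U₀ = 1`
(«(3.35) of [4]» void); (1.34)/(1.40) enter the printed proof only through (1.55) «D*DA = J, |J|₍₋₃₎ ≦ 2α₀ + (α₂-terms)», whose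
α₂-terms (the commutators of (1.43)–(1.54)) are ABSENT in the linear chart and whose `J = D*DA = D*DA′` is gauge invariant
(`B6SectACriticalPointV1.curlCurl_comp_dE`) — so (1.34) is READ as «|D*DA′|₍₋₃₎ ≦ 2α₀», i.e. `|(∂*∂A′)(b)| ≤ 2α₀·(L^{j(b)}η)⁻³`;
(1.35)/(1.66) enter only through (1.37)/(1.42)/(1.56) «Q_j(U₀, ηA) = B, |B| < 2dLα₁», «LʲηQ_jA = B₁, |B₁| < 2dLα₁ + C₂α₂²» with
`C₂α₂² = 0` in the linear chart and `Q_jA = Q_jA′` for restricted `λ` (`B6SectACriticalPointV1.QE_dE_eq_zero` — «(1.37) is basically of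
an algebraic character») — so (1.66) is READ as «|Q_jA′| ≦ 2dLα₁(Lʲη)⁻¹ on Λ_j» (the axial-gauge clause `Ax_k` of (1.34) and the
threshold «α₀ + α₁ ≦ c₁» are NOT needed in the linear chart — the theorem below is stronger for omitting them).  `d`, `L` of print =
`d + 1`, `ℓ + 1` here.

WHAT THIS MODULE PROVES (kernel-checked, 0 sorry, no `… : Prop` fact, THREE theorems; imports `B8Prop3MultiLevelTorusP26` (own, v1.7) +
`B6SectACriticalPointV1` (p21 g5)).
§1 `data_of_restricted` — the two algebraic facts that turn Theorem 4's construction into Proposition 3's hypotheses on the V1 carriers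
   of ANY nested family `D : Domains P`: for `λ ∈ N(Q′)`, `Q(A′ − ∂λ) = QA′` ((1.37); p21's `QE_dE_eq_zero`) and `∂*∂(A′ − ∂λ) = ∂*∂A′`
   ((1.55)'s `J` is gauge invariant; p21's `curlCurl_comp_dE`).
§2 **`thm4_multiLevelTorus_V1`** — THEOREM 4 AT `U₀ = 1` ON THE `k`-LEVEL V1 TORUS: for the weight band `0 < b₀ ≤ b₁` there is `σ₀ > 0`
   such that for every rate `σ ∈ (0, σ₀]` and `α ∈ (0, 1)` there are ONE constant `B₀′ ≥ 1` (Prop. 3's «norm of G(U₀)» at `U₀ = 1`: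
   `K_L(B₀A + 1)(1 + 2b₁)` of `…P26.prop3_multiLevelTorus_V1_P26_vector`) and ONE size threshold `M₄ > 0` such that ON EVERY ADMISSIBLE
   `k`-LEVEL V1 TORUS (`k ≥ 1`, `M_h = Lᵃ ≥ 8`, `R ≥ 2L²`, `P′ ≥ 5L`, `L ≥ 5`, `M₄ ≤ L·M_h`; `c′ ≠ 0`, weights in the band), for every
   `α₀, α₁ ≥ 0` and EVERY perturbation `A′` with `|(∂*∂A′)(b)| ≤ 2α₀·(L^{j(b)}η)⁻³` [(1.34) processed] and `|(Q_jA′)(c)| ≤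
   2dLα₁·(Lʲη)⁻¹` on `Λ_j` [(1.66) processed]: (i) there is EXACTLY ONE `λ ∈ N(Q′)` [(1.29)] with `R∂*(A′ − ∂λ) = 0` [(1.38)] — p21's
   `B6SectACriticalPointV1.existsUnique_gauge212` ([B6] (2.12)) —, and (ii) for it — indeed for any restricted `λ` in the Landau gauge —
   `A := A′ − ∂λ` satisfies (1.37) `QA = QA′`, `∂*∂A = ∂*∂A′`, and with `B₁ := 5dL·B₀′` («B₁ = 5dLB₀») the (1.36)/(1.62) members
   `|A|₍₋₁₎, |∇A|₍₋₂₎ ≤ B₁(α₀ + α₁)`, the (1.39)/(1.62) members `|∂*∂A|(b) ≤ B₁(α₀ + α₁)(L^{j(b)}η)⁻³`, `|ΔA|₍₋₃₎ ≤ B₁(α₀ + α₁)` and the three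
   pointwise «on Ω_j» forms — by `prop3_multiLevelTorus_V1_P26_vector` fed with (1.55) `J := ∂*∂A = ∂*∂A′` (`n_J = 2α₀`), (1.42) the Landau
   clause of `λ`, (1.56) `B := QA = QA′` (`n_B = 2dLα₁`), `α₂ = C₂ = 0` (every smallness line of Prop. 3 then void).
§3 **`thm2_multiLevelTorus_V1`** — the same packaged as Theorem 2's sentence (∃! restricted `u`; (1.36) sup members, (1.37), (1.38),
   (1.39) for `U₁`), as gen 18's `thm2_flat`.

HONEST SCOPE / NOT CLAIMED.  (i) `U₀ = 1` and the LINEAR chart ONLY: the content of Theorems 2/4 at a general regular background (the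
induction of pp. 88–99, Prop. 5, the operators `G′`/`H′` of (1.91) with [4] Thms 3.1–3.2) is NOT touched — rows B8.Thm2 / B8.Thm4 keep
their heads; this is the «without external gauge field» base case, in which the nonlinear gauge fixing of Sects. C–E degenerates to
p21's linear algebra over [B6]'s projection `R` (no threshold `c₁` is needed and none is assumed).  What is NEW relative to gen 18's
`thm4_flat` is print's own multi-level geometry: an ARBITRARY admissible nested family `Ω₁ ⊃ … ⊃ Ω_k` of the torus (through r03's
chart of p21's `TDomains`), the genuine level prefactors `(L^{j}η)^{−1,−2,−3}` of (1.36)/(1.39)/(1.62) and the level-wise restriction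
(1.29)/average condition (1.37) — all of [B6] Prop. 2.6 and its `k`-level assembly (r03/p38/p22/p21, 2026-08-21…23) sit underneath via
v1.5 `_vector`.  (ii) NOT part of the instance: the Hölder member `‖A‖_{1,β} < B₂(β₀)(α₀ + α₁)(Lʲη)^{−2−β}` of (1.36)/(1.62) (operator
`H(U₀)`; the `k`-level Hölder inputs are p38's lane, `B6Prop26HolderGradKLevelV1` pending in the gate 2026-08-24), the strict «<» (we prove «≦»).
(iii) The hypotheses are the PROCESSED forms (1.55)/(1.37) through which (1.34)/(1.35)/(1.66) enter the printed proof at `U₀ = 1` (see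
THE INSTANCE); reading `𝔄_k`-membership of `e^{iηA′}` itself (p40's `B8Eq17ClassAkV1.ClassAk`, as in v1.7 `_U1_classAk`) needs the
(1.41)-type a-priori smallness of `A` that only the theorem provides — print's own order (construct with worse constants, then
improve by Prop. 3, p. 83) — and is not attempted here.  (iv) Constants: `B₁ = 5dL·B₀′` with `B₀′ = K_L(B₀A + 1)(1 + 2b₁)` existential
in `d, L, σ, α, b₀, b₁` (r03's/p38's `A`, this lineage's `B₀, K_L`; print: «depend on d and L only» — the rate `σ` and budget `α` are
[B6]-internal choices, the band `[b₀, b₁]` is print's fixed `a_j`); ONE size threshold `M₄ ≤ L·M_h` inherited from `_vector`.  (v) Real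
scalar fibre (abelian model); non-abelian groups are not modelled (at `U₀ = 1` the linearised problem is the same componentwise).
(vi) Rows B8.Thm4 / B8.Thm2 heads do NOT move.  Value = Theorem 4's existence-uniqueness-bounds sentence kernel-checked in the base case on
print's own multi-level carrier with the printed weights, NOT summit progress; nothing here bears on the Yang–Mills mass gap.

RELATED IN THE TREE, NOT DUPLICATED (stem check 2026-08-24T16:28Z: `ls Balaban1983to89 | grep -i 'Thm4\|gauge212\|Landau.*Torus'` =
`B8Thm4FlatTorus` (own gen 18: one scale, constant domain sequence; §5 `existsUnique_restricted_landau_abstract` = the abstract ∃! for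
any restriction subspace), `B8Thm4LinearDirichlet` (p40 g13: the ∃! on the printed multi-level cube geometry in [4]'s Ω₀ ⊂ T_η DIRICHLET
picture, no bounds), `B8Prop6OfThm4` (abstract carriers); p21's `B6MinimalOrbitV1` is the [B6]-side companion (minimal orbit of (2.5));
none states Theorem 4 with its bounds on the `k`-level torus).  USED BY NAME, nothing re-declared: `B6SectACriticalPointV1.
{existsUnique_gauge212, QE_dE_eq_zero, curlCurl_comp_dE}` (p21 g5), `B6SectAOperatorsV1.{dE, dsE, dcE, dcsE, QE, QpE, RE, ScalarSpace,
BondIdx}` (p21 g5), `B6GlobalChartV1.{PV, domT, blkV1}` (r03), `B6MultiLevelTorusOperator.TDomains` (p21), `B6Geom246MultiLevelTorus.geomT`,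
`B6CubeWindowV1.GlobalBand` (r03), `B6GradLegKLevelV1.DV` (p38), `B8ScaledSupNorm.msup` (p40/r05), own `B8Ineq192MultiLevelTorus.lenT_pos`, own
`B8Prop3MultiLevelTorusP26.prop3_multiLevelTorus_V1_P26_vector` (v1.5, p368650 ✓ 5c1baa6b1e1c, ref-4 Gen 77 SIGNED).
-/

open scoped BigOperators

namespace Literature.MathematicalPhysics.QuantumFieldTheory.Balaban1983to89.B8Thm4MultiLevelTorus

open B6MultiLevelBoxOperator (N0)
open B6MultiLevelTorusOperator (TDomains)
open B6Geom246MultiLevelTorus (geomT)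
open B6GlobalChartV1 (PV domT blkV1)
open B8Ineq192MultiLevelTorus (lenT_pos)
open B6SectADomainsV1 (Domains)
open B6SectAOperatorsV1 (dE dsE dcE dcsE QE QpE RE ScalarSpace BondIdx)
open B6SectACriticalPointV1 (existsUnique_gauge212 QE_dE_eq_zero curlCurl_comp_dE)
open B6CubeWindowV1 (GlobalBand)
open B6GradLegKLevelV1 (DV)
open BalabanImbrieJaffe1984to88.BIJ85AxialPropagator411 (BondSpace)
open B8ScaledSupNorm (msup)
open LatticeFieldCalculus (laplace)
open B8Prop3MultiLevelTorusP26 (prop3_multiLevelTorus_V1_P26_vector)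

noncomputable section

/-! ## §1 The two algebraic facts of the construction at `U₀ = 1` (any nested family on any V1 torus) -/

/-- **(1.37) «is basically of an algebraic character» and (1.55)'s `J` is gauge invariant — at `U₀ = 1` in the linear chart, on the V1
carriers of ANY nested family `D`**: for a restricted gauge parameter `λ ∈ N(Q′)` ([B6] (2.7) = the linearised (1.29)) the gauge-shifted
field `A′ − ∂λ` has the same multi-scale averages, `Q(A′ − ∂λ) = QA′` (p21's `QE_dE_eq_zero`: `Q_j∂λ = ∂^{(j)}Q′_jλ = 0` on `Λ_j`), and the
same `∂*∂`, `∂*∂(A′ − ∂λ) = ∂*∂A′` (p21's `curlCurl_comp_dE`: `∂(∂λ) = 0`). [cite: Balaban1985RegularSpaces, (1.37) p.82 + p.83 («basically of an algebraic character»), (1.55) p.86, (1.29) p.81; Balaban1984PropagatorsII, (2.7) p.224, (2.28)–(2.30) p.227] -/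
theorem data_of_restricted {P : Params} (D : Domains P) (c : ℝ) (A' : BondSpace P) {n : ScalarSpace P}
    (hn : n ∈ LinearMap.ker (QpE D)) :
    QE D (A' - dE c n) = QE D A' ∧ dcsE c (dcE c (A' - dE c n)) = dcsE c (dcE c A') := by
  refine ⟨?_, ?_⟩
  · rw [map_sub, QE_dE_eq_zero D c n hn, sub_zero]
  · have h0 : dcsE c (dcE c (dE c n)) = 0 := by
      have h := LinearMap.congr_fun (curlCurl_comp_dE (P := P) c) n
      simpa only [LinearMap.comp_apply, LinearMap.zero_apply] using h
    rw [map_sub, map_sub, h0, sub_zero]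

/-! ## §2 Theorem 4 at `U₀ = 1` on the `k`-level V1 torus -/

open Classical in
/-- **THEOREM 4 AT THE FLAT BACKGROUND `U₀ = 1` ON THE `k`-LEVEL V1 TORUS** (p. 88, verbatim: *"There exists a constant c₁ such that for
arbitrary U₀, U′U₀ satisfying (1.33), (1.34), (1.66) with α₀ + α₁ ≦ c₁ there exists exactly one gauge transformation u satisfying (1.29)
and such that the conditions (1.37), (1.38), (1.62) hold for the configuration U₁ = U′^{u⁻¹}"*) — typed reading in the linear chart (see
THE INSTANCE): for the weight band `0 < b₀ ≤ b₁` there is `σ₀ > 0` such that for all `σ ∈ (0, σ₀]`, `α ∈ (0, 1)` there are ONE constant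
`B₀′ ≥ 1` and ONE threshold `M₄ > 0` such that on every admissible `k`-level V1 torus (every odd `L ≥ 5`, `k ≥ 1`, `P′ ≥ 5L`), for every
`α₀, α₁ ≥ 0` and every perturbation `A′` with the processed (1.34)/(1.66) sizes `|(∂*∂A′)(b)| ≤ 2α₀(L^{j(b)}η)⁻³`, `|(Q_jA′)(c)| ≤
2dLα₁(Lʲη)⁻¹` on `Λ_j`: (i) «exactly one gauge transformation u satisfying (1.29) and … (1.38)» — `∃! λ ∈ N(Q′)`, `R∂*(A′ − ∂λ) = 0`
(p21's `existsUnique_gauge212`); (ii) for every such `λ`, `A := A′ − ∂λ` satisfies (1.37) `QA = QA′`, `∂*∂A = ∂*∂A′`, and with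
`B₁ = 5dL·B₀′` («B₁ = 5dLB₀», Prop. 3) the members of (1.36)/(1.39)/(1.62): `|A|₍₋₁₎ ≤ B₁(α₀ + α₁)`, `|∇A|₍₋₂₎ ≤ B₁(α₀ + α₁)`,
`|(∂*∂A)(b)| ≤ B₁(α₀ + α₁)(L^{j(b)}η)⁻³`, `|ΔA|₍₋₃₎ ≤ B₁(α₀ + α₁)` and the three pointwise «on Ω_j» forms — own
`prop3_multiLevelTorus_V1_P26_vector` with its B8-side hypotheses (1.55)/(1.42)/(1.56) DISCHARGED (`J := ∂*∂A′`, the Landau clause of `λ`,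
`B := QA′`; `α₂ = C₂ = 0`).  No threshold `c₁`, no [B6]-side hypothesis. [cite: Balaban1985RegularSpaces, Thm 4 p.88, (1.67) p.88, Thm 2 p.83, (1.29) p.81, (1.36)–(1.38) p.82, (1.39) p.83, (1.62) + Prop. 3 p.87, (1.55)–(1.56) p.86, (1.66) p.87; Balaban1984PropagatorsII, (2.7) p.224, (2.12) p.225] -/
theorem thm4_multiLevelTorus_V1 (d ℓ : ℕ) (hd : 1 ≤ d + 1) (hL : Odd (ℓ + 1) ∧ 1 < ℓ + 1) {b₀ b₁ : ℝ} (hb₀ : 0 < b₀) (hb₁ : b₀ ≤ b₁) :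
    ∃ σ₀ : ℝ, 0 < σ₀ ∧ ∀ (σ : ℝ), 0 < σ → σ ≤ σ₀ → ∀ (α : ℝ), 0 < α → α < 1 →
    ∃ B₀' M₄ : ℝ, 1 ≤ B₀' ∧ 0 < M₄ ∧
    ∀ (m K : ℕ) {Mh k R : ℕ} {P' : Fin (d + 1) → ℕ}
      (hN : ∀ μ, N0 ℓ Mh k P' μ = (PV d ℓ m K hd hL).sitesPerDir 0) (D : TDomains d ℓ Mh k P' R) (hk : k ≤ m + K) (_ : 1 ≤ k)
      {a : ℕ} (_ : Mh = (ℓ + 1) ^ a) (_ : 8 ≤ Mh) (_ : 2 * (ℓ + 1) ^ 2 ≤ R) (_ : ∀ μ, 5 * (ℓ + 1) ≤ P' μ) (_ : 4 ≤ ℓ)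
      (_ : M₄ ≤ ((ℓ : ℝ) + 1) * Mh)
      {cf : ℝ} (_ : cf ≠ 0) {w : BondIdx (domT hN D hk) → ℝ} (_ : ∀ i, 0 < w i) (_ : GlobalBand b₀ b₁ cf w),
      ∀ (A' : BondSpace (PV d ℓ m K hd hL)) (α₀ α₁ : ℝ), 0 ≤ α₀ → 0 ≤ α₁ →
        -- (1.34) processed through (1.55) at `U₀ = 1`: `|D*DA′|₍₋₃₎ ≦ 2α₀` (the α₂-terms of (1.55) are absent in the linear chart)
        (∀ b, |dcsE cf (dcE cf A') b| ≤ 2 * α₀ * (((geomT D).len (blkV1 hN D b) * |cf|⁻¹) ^ 3)⁻¹) →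
        -- (1.66)/(1.35) processed through (1.37)/(1.56): `|Q_jA′| ≦ 2dLα₁(Lʲη)⁻¹` on `Λ_j`
        (∀ i, |QE (domT hN D hk) A' i| ≤ 2 * ((d : ℝ) + 1) * ((ℓ : ℝ) + 1) * α₁ * (((ℓ : ℝ) + 1) ^ (i.1.1 : ℕ) * |cf|⁻¹)⁻¹) →
        -- «there exists exactly one gauge transformation u satisfying (1.29) and such that … (1.38)»
        (∃! n : ScalarSpace (PV d ℓ m K hd hL),
            n ∈ LinearMap.ker (QpE (domT hN D hk)) ∧ RE (domT hN D hk) cf (dsE cf (A' - dE cf n)) = 0) ∧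
        -- and for it — indeed for every restricted `λ` in the Landau gauge — `A := A′ − ∂λ` satisfies (1.37), (1.36)/(1.39)/(1.62):
        ∀ n : ScalarSpace (PV d ℓ m K hd hL), n ∈ LinearMap.ker (QpE (domT hN D hk)) →
          RE (domT hN D hk) cf (dsE cf (A' - dE cf n)) = 0 →
          -- (1.37) «basically of an algebraic character»: `QA = QA′`
          QE (domT hN D hk) (A' - dE cf n) = QE (domT hN D hk) A' ∧
          -- (1.55)'s `J = D*DA = D*DA′`
          dcsE cf (dcE cf (A' - dE cf n)) = dcsE cf (dcE cf A') ∧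
          -- (1.36)/(1.62): `|A|₍₋₁₎ ≦ 5dLB₀(α₀ + α₁)`
          msup (ℓ + 1) k |cf|⁻¹ (-1) (fun j (b : PBond (PV d ℓ m K hd hL) 0) => j ≤ (blkV1 hN D b).1.1) (WithLp.ofLp (A' - dE cf n)) ≤
              5 * ((d : ℝ) + 1) * ((ℓ : ℝ) + 1) * B₀' * (α₀ + α₁) ∧
          -- (1.36)/(1.62): `|∇^η_{U₀}A|₍₋₂₎ ≦ 5dLB₀(α₀ + α₁)` (componentwise forward differences at `U₀ = 1`)
          msup (ℓ + 1) k |cf|⁻¹ (-2) (fun j (p : Fin (d + 1) × PBond (PV d ℓ m K hd hL) 0) => j ≤ (blkV1 hN D p.2).1.1)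
              (fun p : Fin (d + 1) × PBond (PV d ℓ m K hd hL) 0 => DV (P := PV d ℓ m K hd hL) p.1 cf (WithLp.ofLp (A' - dE cf n)) p.2) ≤
              5 * ((d : ℝ) + 1) * ((ℓ : ℝ) + 1) * B₀' * (α₀ + α₁) ∧
          -- (1.39)/(1.62): `|D^{η*}_{U₀}D^η_{U₀}A| ≦ 5dLB₀(α₀ + α₁)(Lʲη)⁻³ on Ω_j`
          (∀ b : PBond (PV d ℓ m K hd hL) 0,
              |dcsE cf (dcE cf (A' - dE cf n)) b| ≤ 5 * ((d : ℝ) + 1) * ((ℓ : ℝ) + 1) * B₀' * (α₀ + α₁) *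
                (((geomT D).len (blkV1 hN D b) * |cf|⁻¹) ^ 3)⁻¹) ∧
          -- (1.39)/(1.62): `|Δ^η_{U₀}A|₍₋₃₎ ≦ 5dLB₀(α₀ + α₁)` (componentwise `Δ` at `U₀ = 1`)
          msup (ℓ + 1) k |cf|⁻¹ (-3) (fun j (b : PBond (PV d ℓ m K hd hL) 0) => j ≤ (blkV1 hN D b).1.1)
              (fun b : PBond (PV d ℓ m K hd hL) 0 => laplace cf (fun z => (A' - dE cf n) ⟨z, b.dir⟩) b.src) ≤
              5 * ((d : ℝ) + 1) * ((ℓ : ℝ) + 1) * B₀' * (α₀ + α₁) ∧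
          -- the three pointwise «on Ω_j» forms of (1.36)/(1.39)
          (∀ b : PBond (PV d ℓ m K hd hL) 0,
              |WithLp.ofLp (A' - dE cf n) b| ≤ 5 * ((d : ℝ) + 1) * ((ℓ : ℝ) + 1) * B₀' * (α₀ + α₁) *
                (((geomT D).len (blkV1 hN D b) * |cf|⁻¹) ^ 1)⁻¹) ∧
          (∀ (ν : Fin (d + 1)) (b : PBond (PV d ℓ m K hd hL) 0),
              |DV (P := PV d ℓ m K hd hL) ν cf (WithLp.ofLp (A' - dE cf n)) b| ≤ 5 * ((d : ℝ) + 1) * ((ℓ : ℝ) + 1) * B₀' * (α₀ + α₁) *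
                (((geomT D).len (blkV1 hN D b) * |cf|⁻¹) ^ 2)⁻¹) ∧
          (∀ b : PBond (PV d ℓ m K hd hL) 0,
              |laplace cf (fun z => (A' - dE cf n) ⟨z, b.dir⟩) b.src| ≤ 5 * ((d : ℝ) + 1) * ((ℓ : ℝ) + 1) * B₀' * (α₀ + α₁) *
                (((geomT D).len (blkV1 hN D b) * |cf|⁻¹) ^ 3)⁻¹) := by
  -- Proposition 3 at `U₀ = 1` on the `k`-level V1 torus, no [B6]-side hypothesis (own v1.5 `_vector`)
  obtain ⟨σ₀, hσ₀, h3⟩ := prop3_multiLevelTorus_V1_P26_vector d ℓ hd hL hb₀ hb₁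
  refine ⟨σ₀, hσ₀, fun σ hσ hσle α hα0 hα1 => ?_⟩
  obtain ⟨B₀, KL, hB₀, hKL, Amaj, M₄, hA, hM₄, hP3⟩ := h3 σ hσ hσle α hα0 hα1
  -- Prop. 3's constant «B₀» at `U₀ = 1`: `B₀′ = K_L(B₀A + 1)(1 + 2b₁) ≥ 1`
  have hb₁0 : 0 ≤ b₁ := hb₀.le.trans hb₁
  have hB₀' : (1 : ℝ) ≤ KL * ((B₀ * Amaj + 1) * (1 + 2 * b₁)) := by
    have h1 : (1 : ℝ) ≤ B₀ * Amaj + 1 := le_add_of_nonneg_left (mul_nonneg (zero_le_one.trans hB₀) hA)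
    have h2 : (1 : ℝ) ≤ 1 + 2 * b₁ := le_add_of_nonneg_right (by positivity)
    exact one_le_mul_of_one_le_of_one_le hKL (one_le_mul_of_one_le_of_one_le h1 h2)
  refine ⟨KL * ((B₀ * Amaj + 1) * (1 + 2 * b₁)), M₄, hB₀', hM₄, ?_⟩
  intro m K Mh k R P' hN D hk hk1 a hMha hM8 hR2 hP hℓ4 hM4t cf hcf w hw hwb A' α₀ α₁ hα₀ hα₁ hJ hB
  refine ⟨existsUnique_gauge212 (domT hN D hk) hcf A', fun n hn hLan => ?_⟩
  -- the construction's data: (1.37) `QA = QA′` and `J = ∂*∂A = ∂*∂A′`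
  obtain ⟨h37, h55⟩ := data_of_restricted (domT hN D hk) cf A' hn
  -- print's `d`, `L` as reals: `0 ≤ d`, `1 ≤ dL`
  have hdP : (0 : ℝ) ≤ (d : ℝ) + 1 := by positivity
  have hdL : (1 : ℝ) ≤ ((d : ℝ) + 1) * ((ℓ : ℝ) + 1) :=
    one_le_mul_of_one_le_of_one_le (le_add_of_nonneg_left (Nat.cast_nonneg d)) (le_add_of_nonneg_left (Nat.cast_nonneg ℓ))
  -- Proposition 3 fed with `J := ∂*∂A′`, the Landau clause, `B := QA′`, `n_J = 2α₀`, `n_B = 2dLα₁`, `α₂ = C₂ = 0`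
  have h := hP3 m K hN D hk hk1 hMha hM8 hR2 hP hℓ4 hM4t hcf hw hwb (A' - dE cf n) (dcsE cf (dcE cf A'))
    (QE (domT hN D hk) A') h55 hLan h37 (2 * α₀) (2 * ((d : ℝ) + 1) * ((ℓ : ℝ) + 1) * α₁) (by positivity) (by positivity) hJ hB
    ((d : ℝ) + 1) ((ℓ : ℝ) + 1) 0 α₀ α₁ 0 hdP hdL hα₀ hα₁ le_rfl (le_of_eq (by ring)) (le_of_eq (by ring)) (by norm_num) (by norm_num)
    (by norm_num; exact add_nonneg hα₀ hα₁)
  obtain ⟨hA1, hA2, hJ3, hA4, hp1, hp2, hp3⟩ := h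
  refine ⟨h37, h55, hA1, hA2, fun b => ?_, hA4, hp1, hp2, hp3⟩
  -- (1.39)/(1.62) for `D*DA = J`: `|J(b)| ≤ 2α₀·w₃(b) ≤ B₁(α₀ + α₁)·w₃(b)`
  have hw3 : (0 : ℝ) ≤ (((geomT D).len (blkV1 hN D b) * |cf|⁻¹) ^ 3)⁻¹ :=
    inv_nonneg.2 (pow_nonneg (mul_nonneg (lenT_pos D _).le (inv_nonneg.2 (abs_nonneg cf))) 3)
  rw [h55]
  exact (hJ b).trans (mul_le_mul_of_nonneg_right hJ3 hw3)

/-! ## §3 Theorem 2 at `U₀ = 1` on the `k`-level V1 torus -/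

open Classical in
/-- **THEOREM 2 AT THE FLAT BACKGROUND `U₀ = 1` ON THE `k`-LEVEL V1 TORUS** («Of course this theorem implies Theorem 2», p. 88): with
the constant `B₁ = 5dL·B₀′` of `thm4_multiLevelTorus_V1` — *"There exist constants B₁, … such that for arbitrary U₀, U′U₀ satisfying
(1.33)–(1.35) … there exists exactly one gauge transformation u satisfying (1.29) and such that the conditions (1.36)–(1.39) hold for the
configuration U₁ = U′^{u⁻¹}"* — read in the linear chart on the multi-level torus: ∃! restricted `λ ∈ N(Q′)` in the Landau gauge
(1.38), and for it (1.36) `|A|₍₋₁₎, |∇^η_{U₀}A|₍₋₂₎ ≦ B₁(α₀ + α₁)`, (1.37) `Q_jA = Q_jA′` («|B| < 2dLα₁ by the assumption (1.35)»),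
(1.39) `|D^{η*}_{U₀}D^η_{U₀}A| ≦ B₁(α₀ + α₁)(Lʲη)⁻³ on Ω_j`, `|Δ^η_{U₀}A|₍₋₃₎ ≦ B₁(α₀ + α₁)`.  The Hölder member of (1.36) is not part
of the instance (HONEST SCOPE (ii)). [cite: Balaban1985RegularSpaces, Thm 2 p.83, (1.36)–(1.38) p.82, (1.39) p.83, (1.29) p.81, Thm 4 p.88; Balaban1984PropagatorsII, (2.7) p.224, (2.12) p.225] -/
theorem thm2_multiLevelTorus_V1 (d ℓ : ℕ) (hd : 1 ≤ d + 1) (hL : Odd (ℓ + 1) ∧ 1 < ℓ + 1) {b₀ b₁ : ℝ} (hb₀ : 0 < b₀) (hb₁ : b₀ ≤ b₁) :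
    ∃ σ₀ : ℝ, 0 < σ₀ ∧ ∀ (σ : ℝ), 0 < σ → σ ≤ σ₀ → ∀ (α : ℝ), 0 < α → α < 1 →
    ∃ B₁ M₄ : ℝ, 1 ≤ B₁ ∧ 0 < M₄ ∧
    ∀ (m K : ℕ) {Mh k R : ℕ} {P' : Fin (d + 1) → ℕ}
      (hN : ∀ μ, N0 ℓ Mh k P' μ = (PV d ℓ m K hd hL).sitesPerDir 0) (D : TDomains d ℓ Mh k P' R) (hk : k ≤ m + K) (_ : 1 ≤ k)
      {a : ℕ} (_ : Mh = (ℓ + 1) ^ a) (_ : 8 ≤ Mh) (_ : 2 * (ℓ + 1) ^ 2 ≤ R) (_ : ∀ μ, 5 * (ℓ + 1) ≤ P' μ) (_ : 4 ≤ ℓ)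
      (_ : M₄ ≤ ((ℓ : ℝ) + 1) * Mh)
      {cf : ℝ} (_ : cf ≠ 0) {w : BondIdx (domT hN D hk) → ℝ} (_ : ∀ i, 0 < w i) (_ : GlobalBand b₀ b₁ cf w),
      ∀ (A' : BondSpace (PV d ℓ m K hd hL)) (α₀ α₁ : ℝ), 0 ≤ α₀ → 0 ≤ α₁ →
        (∀ b, |dcsE cf (dcE cf A') b| ≤ 2 * α₀ * (((geomT D).len (blkV1 hN D b) * |cf|⁻¹) ^ 3)⁻¹) →
        (∀ i, |QE (domT hN D hk) A' i| ≤ 2 * ((d : ℝ) + 1) * ((ℓ : ℝ) + 1) * α₁ * (((ℓ : ℝ) + 1) ^ (i.1.1 : ℕ) * |cf|⁻¹)⁻¹) →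
        ∃! n : ScalarSpace (PV d ℓ m K hd hL),
          -- (1.29) restricted, (1.38) Landau gauge
          n ∈ LinearMap.ker (QpE (domT hN D hk)) ∧ RE (domT hN D hk) cf (dsE cf (A' - dE cf n)) = 0 ∧
          -- (1.37)
          QE (domT hN D hk) (A' - dE cf n) = QE (domT hN D hk) A' ∧
          -- (1.36) sup members
          msup (ℓ + 1) k |cf|⁻¹ (-1) (fun j (b : PBond (PV d ℓ m K hd hL) 0) => j ≤ (blkV1 hN D b).1.1) (WithLp.ofLp (A' - dE cf n)) ≤
              B₁ * (α₀ + α₁) ∧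
          msup (ℓ + 1) k |cf|⁻¹ (-2) (fun j (p : Fin (d + 1) × PBond (PV d ℓ m K hd hL) 0) => j ≤ (blkV1 hN D p.2).1.1)
              (fun p : Fin (d + 1) × PBond (PV d ℓ m K hd hL) 0 => DV (P := PV d ℓ m K hd hL) p.1 cf (WithLp.ofLp (A' - dE cf n)) p.2) ≤
              B₁ * (α₀ + α₁) ∧
          -- (1.39)
          (∀ b : PBond (PV d ℓ m K hd hL) 0,
              |dcsE cf (dcE cf (A' - dE cf n)) b| ≤ B₁ * (α₀ + α₁) * (((geomT D).len (blkV1 hN D b) * |cf|⁻¹) ^ 3)⁻¹) ∧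
          msup (ℓ + 1) k |cf|⁻¹ (-3) (fun j (b : PBond (PV d ℓ m K hd hL) 0) => j ≤ (blkV1 hN D b).1.1)
              (fun b : PBond (PV d ℓ m K hd hL) 0 => laplace cf (fun z => (A' - dE cf n) ⟨z, b.dir⟩) b.src) ≤ B₁ * (α₀ + α₁) := by
  obtain ⟨σ₀, hσ₀, h4⟩ := thm4_multiLevelTorus_V1 d ℓ hd hL hb₀ hb₁
  refine ⟨σ₀, hσ₀, fun σ hσ hσle α hα0 hα1 => ?_⟩
  obtain ⟨B₀', M₄, hB₀', hM₄, h⟩ := h4 σ hσ hσle α hα0 hα1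
  have hdL : (1 : ℝ) ≤ ((d : ℝ) + 1) * ((ℓ : ℝ) + 1) :=
    one_le_mul_of_one_le_of_one_le (le_add_of_nonneg_left (Nat.cast_nonneg d)) (le_add_of_nonneg_left (Nat.cast_nonneg ℓ))
  refine ⟨5 * ((d : ℝ) + 1) * ((ℓ : ℝ) + 1) * B₀', M₄, ?_, hM₄, ?_⟩
  · -- `1 ≤ 5dL·B₀′`
    calc (1 : ℝ) ≤ 5 * (((d : ℝ) + 1) * ((ℓ : ℝ) + 1)) * 1 := by linarith
      _ ≤ 5 * (((d : ℝ) + 1) * ((ℓ : ℝ) + 1)) * B₀' := mul_le_mul_of_nonneg_left hB₀' (by positivity)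
      _ = 5 * ((d : ℝ) + 1) * ((ℓ : ℝ) + 1) * B₀' := by ring
  intro m K Mh k R P' hN D hk hk1 a hMha hM8 hR2 hP hℓ4 hM4t cf hcf w hw hwb A' α₀ α₁ hα₀ hα₁ hJ hB
  obtain ⟨⟨n, ⟨hn, hLan⟩, huniq⟩, hall⟩ :=
    h m K hN D hk hk1 hMha hM8 hR2 hP hℓ4 hM4t hcf hw hwb A' α₀ α₁ hα₀ hα₁ hJ hB
  obtain ⟨h37, _, hA1, hA2, hJ3, hA4, _, _, _⟩ := hall n hn hLan
  exact ⟨n, ⟨hn, hLan, h37, hA1, hA2, hJ3, hA4⟩, fun n' h' => huniq n' ⟨h'.1, h'.2.1⟩⟩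

end

end Literature.MathematicalPhysics.QuantumFieldTheory.Balaban1983to89.B8Thm4MultiLevelTorus
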